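import Literature.Analysis.FluidPDE.HelmholtzAnnihilator
import HarnessLib

/-!
# Liouville for bounded harmonic functions and the annihilator lemma in `L^∞(ℝⁿ)`

Analysis/FluidPDE support file (all results proved) for the named fact
`Literature.Analysis.FluidPDE.knss_bound_C_over_r` (`SelfSimilarLiouville`; Koch–Nadirashvili–Seregin–Šverák 2009,
Theorem 5.3) and its companions `KNSSLiouville`, `AncientMildPairing`: the `L^∞` counterpart of
the `L^p` annihilator lemma of `Literature.Analysis.FluidPDE.HelmholtzAnnihilator`. In the
tree's duality-form class of bounded ancient mild solutions each slice `u(t)` is a bounded,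
weakly divergence-free field determined only through its pairings with divergence-free tests;
the lemma below says exactly what such pairings determine — the field up to an additive
constant. This is the fact KNSS invoke at the end of the proofs of their Liouville theorems
(arXiv:0709.3599, proof of Theorem 5.1, p. 9: "`curl u = 0` … together with `div u = 0` and the
boundedness of `u`, implies (by the classical Liouville theorem for harmonic functions) that `u`
is constant in `x`"; Lemma 3.1, p. 7: "bounded solutions of the system `curl z = 0` and
`div z = 0` in `ℝⁿ` are constant by Liouville's theorem"), here with "irrotational" known only
weakly (annihilation of the solenoidal tests).

**Main results** (finite-dimensional real inner product space `E` with Lebesgue measure).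

* `InnerProductSpace.HarmonicOnNhd.apply_eq_apply_of_abs_le` (**Liouville for bounded harmonic
  functions**): a function harmonic on all of `E` and bounded is constant.
* `Literature.Analysis.FluidPDE.abs_normed_convolution_le`: mollification by a normalised bump does not increase
  the sup norm.
* `Literature.Analysis.FluidPDE.IsWeaklyDivFree.exists_ae_eq_const_of_norm_le_of_forall_integral_inner_eq_zero`
  (**annihilator lemma in `L^∞`**): a bounded measurable weakly divergence-free field `w` with
  `∫ ⟪w, φ⟫ = 0` for all `φ ∈ C_c^∞(E; E)`, `div φ = 0`, is a.e. equal to a constant.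

## Proofs

*Liouville* (Gilbarg–Trudinger, Thm. 2.1 and the comparison of mean values; Evans, *PDE*,
§2.2.3 (c)): with the cone weights `ρ_R(x) = max(1 - ‖x‖/R, 0)` of `HelmholtzAnnihilator` and
the weighted mean value property of the tree (`Literature.Analysis.FluidPDE.integral_radial_mul_harmonic`),
`Rⁿ (∫ρ₁) (η(x₀) - η(x₁)) = ∫ (ρ_R(y - x₀) - ρ_R(y - x₁)) η(y) dy`; the kernel difference is at
most `‖x₀ - x₁‖/R` in absolute value (`ρ` is `1`-Lipschitz) and vanishes off
`B̄(x₀, R) ∪ B̄(x₁, R)`, whose volume is `2 Rⁿ |B̄₁|`, so `|η(x₀) - η(x₁)| ≤ 2M|B̄₁|‖x₀ - x₁‖ /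
((∫ρ₁) R) → 0`.

*Annihilator lemma* (the proof of `HelmholtzAnnihilator`, Lemarié-Rieusset 2016, proof of
Thm. 4.4, pp. 56–57, run on mollifications): the components `hₖ = φₖ ⋆ ⟪w, a⟫` of the
mollifications are harmonic (`integral_laplacian_mul_inner_eq_zero`,
`laplacian_convolution_lsmul`) and bounded, hence constant by Liouville; since `hₖ → ⟪w, a⟫`
a.e. (Lebesgue differentiation, `ae_tendsto_normed_convolution`), `⟪w, a⟫` is a.e. equal to the
limit of the constants `hₖ(0)`, for every `a` of an orthonormal frame.

## References

* G. Koch, N. Nadirashvili, G. Seregin, V. Šverák, *Liouville theorems for the Navier–Stokes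
  equations and applications*, Acta Math. 203 (2009) = arXiv:0709.3599, Lemma 3.1 (p. 7) and
  the proof of Theorem 5.1 (p. 9). [KochNadirashviliSereginSverak2009]
* D. Gilbarg, N. S. Trudinger, *Elliptic partial differential equations of second order*
  (Springer, 2001 reprint), Thm. 2.1 (mean value property). [GilbargTrudinger2001]
* L. C. Evans, *Partial Differential Equations*, 2nd ed. (AMS 2010), §2.2.3 (c) (Liouville's
  theorem), App. C.4, Thm. 7 (mollifiers). [Evans2010]
* P. G. Lemarié-Rieusset, *The Navier–Stokes problem in the 21st century*, CRC Press 2016,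
  proof of Thm. 4.4 (pp. 56–57). [LemarieRieusset2016]
-/

noncomputable section

open MeasureTheory TopologicalSpace Set Function Filter Topology InnerProductSpace
  ContinuousLinearMap Metric
open scoped RealInnerProductSpace ENNReal NNReal Convolution ContDiff Laplacian

namespace Literature.Analysis.FluidPDE

variable {E : Type*} [NormedAddCommGroup E] [InnerProductSpace ℝ E] [FiniteDimensional ℝ E]
  [MeasurableSpace E] [BorelSpace E]

/-! ### Liouville's theorem for bounded harmonic functions -/

section Liouville

/-- **Liouville's theorem for bounded harmonic functions.** On a finite-dimensional real inner
product space, a function harmonic on all of `E` and bounded (`|η| ≤ M`) is constant: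
`η x₀ = η x₁` for all `x₀, x₁` (Evans, *PDE*, §2.2.3 (c); Gilbarg–Trudinger, Thm. 2.1 and the
comparison of mean values over large balls, here in the weighted radial form
`Literature.Analysis.FluidPDE.integral_radial_mul_harmonic` with the cone weights `max(1 - ‖x‖/R, 0)`; see the module
docstring). KNSS 2009 use it in Lemma 3.1 and at the end of the proof of Theorem 5.1. [cite: GilbargTrudinger2001, Thm 2.1] -/
theorem _root_.InnerProductSpace.HarmonicOnNhd.apply_eq_apply_of_abs_le {η : E → ℝ}
    (hη : HarmonicOnNhd η univ) {M : ℝ} (hM : ∀ x, |η x| ≤ M) (x₀ x₁ : E) : η x₀ = η x₁ := by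
  rcases subsingleton_or_nontrivial E with hE | hE
  · rw [Subsingleton.elim x₀ x₁]
  have hM0 : 0 ≤ M := (abs_nonneg _).trans (hM 0)
  have hηc : Continuous η := (Literature.Analysis.FluidPDE.contDiff_two_of_harmonicOnNhd_univ hη).continuous
  -- the cone weight `ρ(x) = max(1 - ‖x‖, 0)`
  set ρ : E → ℝ := fun x => max (1 - ‖x‖) 0 with hρ_def
  have hρc : Continuous ρ := (continuous_const.sub continuous_norm).max continuous_const
  have hρ0 : ∀ x, 0 ≤ ρ x := fun x => le_max_right _ _
  have hρz : ∀ x : E, 1 ≤ ‖x‖ → ρ x = 0 := fun x hx => max_eq_right (by linarith)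
  have hρs : HasCompactSupport ρ := by
    refine HasCompactSupport.intro (isCompact_closedBall (0 : E) 1) fun x hx => hρz x ?_
    rw [mem_closedBall_zero_iff, not_le] at hx
    exact hx.le
  have hρrad : ∀ x y : E, ‖x‖ = ‖y‖ → ρ x = ρ y := fun x y h => by simp [hρ_def, h]
  have hρi : Integrable ρ volume := hρc.integrable_of_hasCompactSupport hρs
  have hI : 0 < ∫ x, ρ x := by
    rw [integral_pos_iff_support_of_nonneg hρ0 hρi]
    refine hρc.isOpen_support.measure_pos volume ⟨0, ?_⟩
    simp [hρ_def]
  set I := ∫ x, ρ x with hI_def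
  have hρlip : ∀ a b : E, |ρ a - ρ b| ≤ ‖a - b‖ := fun a b => by
    calc |ρ a - ρ b| = |max (1 - ‖a‖) 0 - max (1 - ‖b‖) 0| := rfl
      _ ≤ |(1 - ‖a‖) - (1 - ‖b‖)| := abs_max_sub_max_le_abs _ _ _
      _ = |‖b‖ - ‖a‖| := by ring_nf
      _ ≤ ‖b - a‖ := abs_norm_sub_norm_le b a
      _ = ‖a - b‖ := norm_sub_rev _ _
  set n := Module.finrank ℝ E with hn_def
  -- scaled weights
  set ρR : ℝ → E → ℝ := fun R x => ρ (R⁻¹ • x) with hρR_def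
  have hρRc : ∀ R, Continuous (ρR R) := fun R => hρc.comp (continuous_const.smul continuous_id)
  have hρRs : ∀ R, 0 < R → HasCompactSupport (ρR R) := fun R hR =>
    hρs.comp_smul (inv_ne_zero hR.ne')
  have hρRrad : ∀ R (x y : E), ‖x‖ = ‖y‖ → ρR R x = ρR R y := fun R x y h =>
    hρrad _ _ (by simp [norm_smul, h])
  have hmass : ∀ R, 0 < R → ∫ x, ρR R x = R ^ n * I := fun R hR => by
    have h := Measure.integral_comp_inv_smul_of_nonneg volume ρ hR.le
    simpa [hρR_def, smul_eq_mul] using h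
  have hρRlip : ∀ R, 0 < R → ∀ a b : E, |ρR R a - ρR R b| ≤ R⁻¹ * ‖a - b‖ := by
    intro R hR a b
    calc |ρR R a - ρR R b| = |ρ (R⁻¹ • a) - ρ (R⁻¹ • b)| := rfl
      _ ≤ ‖R⁻¹ • a - R⁻¹ • b‖ := hρlip _ _
      _ = R⁻¹ * ‖a - b‖ := by
        rw [← smul_sub, norm_smul, Real.norm_of_nonneg (inv_nonneg.2 hR.le)]
  have hρRz : ∀ R, 0 < R → ∀ z : E, R ≤ ‖z‖ → ρR R z = 0 := by
    intro R hR z hz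
    refine hρz _ ?_
    rw [norm_smul, Real.norm_of_nonneg (inv_nonneg.2 hR.le)]
    rw [← div_eq_inv_mul, le_div_iff₀ hR, one_mul]
    exact hz
  -- volume of balls
  set V : ℝ := (volume : Measure E).real (closedBall (0 : E) 1) with hV_def
  have hV0 : 0 ≤ V := measureReal_nonneg
  have hball : ∀ (x : E) (R : ℝ), 0 < R →
      (volume : Measure E).real (closedBall x R) = R ^ n * V := fun x R hR =>
    Measure.addHaar_real_closedBall' volume x hR.le
  -- the key estimate for every radius
  have key : ∀ R : ℝ, 0 < R →
      I * |η x₀ - η x₁| ≤ 2 * M * V * ‖x₀ - x₁‖ * R⁻¹ := by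
    intro R hR
    have hRn : (0 : ℝ) < R ^ n := pow_pos hR n
    have mvp₀ := Literature.Analysis.FluidPDE.integral_radial_mul_harmonic hη (hρRc R) (hρRs R hR) (hρRrad R) x₀
    have mvp₁ := Literature.Analysis.FluidPDE.integral_radial_mul_harmonic hη (hρRc R) (hρRs R hR) (hρRrad R) x₁
    -- translate the weights to the centres
    have shift : ∀ z : E, ∫ y, ρR R (y - z) * η y = ∫ x, ρR R x * η (z + x) := fun z => by
      rw [← integral_sub_right_eq_self (fun x => ρR R x * η (z + x)) z]
      refine integral_congr_ae (ae_of_all _ fun y => ?_)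
      simp only [add_sub_cancel]
    -- integrability of the translated products
    have hint : ∀ z : E, Integrable (fun y => ρR R (y - z) * η y) volume := fun z => by
      have hc : Continuous fun y => ρR R (y - z) * η y :=
        ((hρRc R).comp (continuous_id.sub continuous_const)).mul hηc
      have hs : HasCompactSupport fun y => ρR R (y - z) * η y := by
        refine HasCompactSupport.mul_right ?_
        have h := (hρRs R hR).comp_homeomorph (Homeomorph.addRight (-z))
        have e : (fun y => ρR R (y - z)) = ρR R ∘ (Homeomorph.addRight (-z)) := by
          funext y
          simp [sub_eq_add_neg]
        rw [e]
        exact h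
      exact hc.integrable_of_hasCompactSupport hs
    -- the difference of the two mean value identities
    have hdiff : (R ^ n * I) * (η x₀ - η x₁) =
        ∫ y, (ρR R (y - x₀) - ρR R (y - x₁)) * η y := by
      have e : (fun y => (ρR R (y - x₀) - ρR R (y - x₁)) * η y) =
          fun y => ρR R (y - x₀) * η y - ρR R (y - x₁) * η y := by
        ext y; ring
      rw [e, integral_sub (hint x₀) (hint x₁), shift x₀, shift x₁, mvp₀, mvp₁, hmass R hR]
      ring
    -- the integrand vanishes off `B̄(x₀, R) ∪ B̄(x₁, R)` and is bounded by `R⁻¹ ‖x₀ - x₁‖ M`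
    set S : Set E := closedBall x₀ R ∪ closedBall x₁ R with hS
    have hSfin : volume S < (⊤ : ℝ≥0∞) :=
      ((isCompact_closedBall x₀ R).union (isCompact_closedBall x₁ R)).measure_lt_top
    have hvanish : ∀ y ∉ S, (ρR R (y - x₀) - ρR R (y - x₁)) * η y = 0 := by
      intro y hy
      rw [hS, mem_union, not_or, mem_closedBall, mem_closedBall, dist_eq_norm, dist_eq_norm,
        not_le, not_le] at hy
      rw [hρRz R hR _ hy.1.le, hρRz R hR _ hy.2.le, sub_self, zero_mul]
    have hptw : ∀ y ∈ S, ‖(ρR R (y - x₀) - ρR R (y - x₁)) * η y‖ ≤ R⁻¹ * ‖x₀ - x₁‖ * M := by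
      intro y _
      rw [norm_mul, Real.norm_eq_abs, Real.norm_eq_abs]
      have h1 : |ρR R (y - x₀) - ρR R (y - x₁)| ≤ R⁻¹ * ‖x₀ - x₁‖ := by
        have h := hρRlip R hR (y - x₀) (y - x₁)
        rwa [sub_sub_sub_cancel_left, norm_sub_rev] at h
      exact mul_le_mul h1 (hM y) (abs_nonneg _)
        (mul_nonneg (inv_nonneg.2 hR.le) (norm_nonneg _))
    have hmeasS : volume.real S ≤ 2 * (R ^ n * V) := by
      calc volume.real S ≤ volume.real (closedBall x₀ R) + volume.real (closedBall x₁ R) :=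
            measureReal_union_le _ _
        _ = 2 * (R ^ n * V) := by rw [hball x₀ R hR, hball x₁ R hR]; ring
    have hnorm : ‖∫ y, (ρR R (y - x₀) - ρR R (y - x₁)) * η y‖ ≤
        R⁻¹ * ‖x₀ - x₁‖ * M * (2 * (R ^ n * V)) := by
      rw [← setIntegral_eq_integral_of_forall_compl_eq_zero hvanish]
      refine (norm_setIntegral_le_of_norm_le_const hSfin hptw).trans ?_
      exact mul_le_mul_of_nonneg_left hmeasS
        (mul_nonneg (mul_nonneg (inv_nonneg.2 hR.le) (norm_nonneg _)) hM0)
    rw [← hdiff, Real.norm_eq_abs, abs_mul, abs_of_pos (mul_pos hRn hI)] at hnorm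
    -- divide by `Rⁿ`
    have h2 : R ^ n * (I * |η x₀ - η x₁|) ≤ R ^ n * (2 * M * V * ‖x₀ - x₁‖ * R⁻¹) := by
      calc R ^ n * (I * |η x₀ - η x₁|) = R ^ n * I * |η x₀ - η x₁| := by ring
        _ ≤ R⁻¹ * ‖x₀ - x₁‖ * M * (2 * (R ^ n * V)) := hnorm
        _ = R ^ n * (2 * M * V * ‖x₀ - x₁‖ * R⁻¹) := by ring
    exact le_of_mul_le_mul_left h2 hRn
  -- let `R → ∞`
  have hlim : Tendsto (fun R : ℝ => 2 * M * V * ‖x₀ - x₁‖ * R⁻¹) atTop (𝓝 0) := by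
    simpa using tendsto_inv_atTop_zero.const_mul (2 * M * V * ‖x₀ - x₁‖)
  have hle : I * |η x₀ - η x₁| ≤ 0 :=
    ge_of_tendsto hlim (Filter.eventually_atTop.2 ⟨1, fun R hR => key R (by linarith)⟩)
  have habs0 : |η x₀ - η x₁| ≤ 0 := by
    by_contra h
    exact absurd hle (not_le.2 (mul_pos hI (not_le.1 h)))
  exact sub_eq_zero.1 (abs_nonpos_iff.1 habs0)

end Liouville

/-! ### Mollification does not increase the sup norm -/

section Mollify

/-- Mollification by a normalised bump does not increase the sup norm: if `|g| ≤ K` then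
`|(φ.normed ⋆ g)(x)| ≤ K` for every `x` (the kernel is nonnegative with unit mass; Evans, *PDE*,
App. C.4, Thm. 7). [cite: Evans2010, App. C.4 Thm. 7] -/
theorem abs_normed_convolution_le (φ : ContDiffBump (0 : E)) {g : E → ℝ} {K : ℝ}
    (hK : ∀ y, |g y| ≤ K) (x : E) : |(φ.normed volume ⋆[lsmul ℝ ℝ, volume] g) x| ≤ K := by
  rw [convolution_def]
  simp only [lsmul_apply, smul_eq_mul]
  have hi : Integrable (fun t => φ.normed volume t * K) volume := φ.integrable_normed.mul_const K
  have h := norm_integral_le_of_norm_le hi (Eventually.of_forall fun t => (?_ :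
    ‖φ.normed volume t * g (x - t)‖ ≤ φ.normed volume t * K))
  · rw [integral_mul_const, φ.integral_normed, one_mul, Real.norm_eq_abs] at h
    exact h
  · rw [norm_mul, Real.norm_of_nonneg (φ.nonneg_normed t), Real.norm_eq_abs]
    exact mul_le_mul_of_nonneg_left (hK _) (φ.nonneg_normed t)

end Mollify

/-! ### The annihilator lemma in `L^∞` -/

section Annihilator

/-- **Annihilator lemma in `L^∞` (a bounded field which is weakly solenoidal and weakly
irrotational is constant), PROVED.** Let `E` be a finite-dimensional real inner product space
with its Lebesgue measure. If `w : E → E` is a.e. strongly measurable and bounded (`‖w‖ ≤ M`),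
weakly divergence free (`∫ ⟪w, ∇θ⟫ = 0` for `θ ∈ C_c^∞`) and `∫ ⟪w, φ⟫ = 0` for every
`φ ∈ C_c^∞(E; E)` with `div φ = 0`, then `w` is a.e. equal to a constant. (KNSS 2009, Lemma 3.1,
arXiv:0709.3599 p. 7: "bounded solutions of the system `curl z = 0` and `div z = 0` in `ℝⁿ` are
constant by Liouville's theorem", and the end of the proof of Theorem 5.1, p. 9; here
irrotationality is only known weakly, as annihilation of the solenoidal tests, which is what the
duality-form class of mild solutions provides.) Proof as in
`IsWeaklyDivFree.ae_eq_zero_of_add_memLp_of_forall_integral_inner_eq_zero`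
(Lemarié-Rieusset 2016, proof of Thm. 4.4, run on mollifications): the components
`hₖ = φₖ ⋆ ⟪w, a⟫` are harmonic and bounded, hence constant
(`HarmonicOnNhd.apply_eq_apply_of_abs_le`), and `hₖ → ⟪w, a⟫` a.e. [cite: KochNadirashviliSereginSverak2009, Lemma 3.1 (arXiv p. 7)] -/
theorem IsWeaklyDivFree.exists_ae_eq_const_of_norm_le_of_forall_integral_inner_eq_zero
    {w : E → E} (hw : AEStronglyMeasurable w volume) {M : ℝ} (hM : ∀ x, ‖w x‖ ≤ M)
    (hdiv : IsWeaklyDivFree w)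
    (horth : ∀ φ : E → E, FunctionSpaces.IsTestFunctionOn (⊤ : Opens E) φ → VectorCalculus.IsDivFree φ →
      ∫ x, ⟪w x, φ x⟫ = 0) :
    ∃ c : E, w =ᵐ[volume] fun _ => c := by
  set b := stdOrthonormalBasis ℝ E
  have hwtop : MemLp w (⊤ : ℝ≥0∞) (volume : Measure E) :=
    memLp_top_of_bound hw M (Eventually.of_forall hM)
  have hwl : LocallyIntegrable w volume := hwtop.locallyIntegrable le_top
  obtain ⟨φ, hφ0, hφ2⟩ := FunctionSpaces.exists_contDiffBump_seq (E := E)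
  -- every component `⟪w, a⟫` is a.e. equal to a constant
  have hcomp : ∀ a : E, ∃ c : ℝ, ∀ᵐ y ∂(volume : Measure E), ⟪w y, a⟫ = c := by
    intro a
    set wa : E → ℝ := fun y => ⟪w y, a⟫ with hwa_def
    have hwal : LocallyIntegrable wa volume := (hwtop.inner_const a).locallyIntegrable le_top
    have hwab : ∀ y, |wa y| ≤ M * ‖a‖ := fun y =>
      (abs_real_inner_le_norm _ _).trans (mul_le_mul_of_nonneg_right (hM y) (norm_nonneg _))
    -- each mollification is a bounded harmonic function, hence constant
    have hconst : ∀ (k : ℕ) (x : E), ((φ k).normed volume ⋆[lsmul ℝ ℝ, volume] wa) x =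
        ((φ k).normed volume ⋆[lsmul ℝ ℝ, volume] wa) 0 := by
      intro k
      set ψ : E → ℝ := (φ k).normed volume with hψ_def
      have hψ : FunctionSpaces.IsTestFunctionOn (⊤ : Opens E) ψ := FunctionSpaces.isTestFunctionOn_normed (φ k)
      have hψ2 : ContDiff ℝ 2 ψ := contDiff_infty.1 hψ.contDiff 2
      have hh2 : ContDiff ℝ 2 (ψ ⋆[lsmul ℝ ℝ, volume] wa) :=
        hψ.hasCompactSupport.contDiff_convolution_left _ hψ2 hwal
      have hΔ : ∀ x, Δ (ψ ⋆[lsmul ℝ ℝ, volume] wa) x = 0 := by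
        intro x
        rw [laplacian_convolution_lsmul hψ2 hψ.hasCompactSupport hwal x, convolution_def]
        simp only [lsmul_apply, smul_eq_mul]
        have e := integral_sub_left_eq_self (fun t => (Δ ψ) t * wa (x - t)) volume x
        simp only [sub_sub_cancel] at e
        rw [← e]
        have hθ : FunctionSpaces.IsTestFunctionOn (⊤ : Opens E) (fun z => ψ (x - z)) := hψ.comp_sub_left x
        have key := integral_laplacian_mul_inner_eq_zero hwl hdiv horth hθ a
        simp_rw [laplacian_comp_sub_left hψ2 x] at key
        exact key
      have hharm : HarmonicOnNhd (ψ ⋆[lsmul ℝ ℝ, volume] wa) univ := fun x _ =>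
        ⟨hh2.contDiffAt, Eventually.of_forall fun y => hΔ y⟩
      have hbdd : ∀ x, |(ψ ⋆[lsmul ℝ ℝ, volume] wa) x| ≤ M * ‖a‖ := fun x =>
        abs_normed_convolution_le (φ k) hwab x
      exact fun x => hharm.apply_eq_apply_of_abs_le hbdd x 0
    -- the constants converge to `⟪w, a⟫` a.e.
    have hlim := FunctionSpaces.ae_tendsto_normed_convolution hφ0 hφ2 hwal
    refine ⟨limUnder atTop fun k => ((φ k).normed volume ⋆[lsmul ℝ ℝ, volume] wa) 0, ?_⟩
    filter_upwards [hlim] with x hx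
    simp_rw [hconst] at hx
    exact (hx.limUnder_eq).symm
  -- assemble along an orthonormal frame
  choose c hc using hcomp
  have hall : ∀ᵐ y ∂(volume : Measure E), ∀ i, ⟪w y, b i⟫ = c (b i) :=
    ae_all_iff.2 fun i => hc (b i)
  refine ⟨∑ i, c (b i) • b i, ?_⟩
  filter_upwards [hall] with y hy
  rw [← b.sum_repr' (w y)]
  exact Finset.sum_congr rfl fun i _ => by rw [real_inner_comm, hy i]

end Annihilator

end Literature.Analysis.FluidPDE
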